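import Summits.QuantumFields.YangMills.Theorems.FluctuationComparisonRegPrIntLS2BetaRelativeTowerSupProfileStart
import Summits.QuantumFields.YangMills.Theorems.FluctuationComparisonRegPrIntLS2BetaContractingSupStart
import Summits.QuantumFields.YangMills.Theorems.FluctuationComparisonRegPrIntLS2BetaThresholdSum
import Summits.QuantumFields.YangMills.Theorems.FluctuationComparisonRegPrIntLS2BetaClosePairOfOneStep
import HarnessLib

/-!
# S2β · the (D♮) REL-TEL road — THE SUP BUDGET OF A STAGE TOWER OVER A NON-FLAT DATUM IN THE T³ READING: for `γ ≤ γ₁(L, b₀, p₀)` and a datum `V`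
# whose bonds have arcs `≤ M(L)` (its small-bond gauge), every gauged level of the stage tower of a good history `U ∈ fibre(V)` has arcs `≤ M ≤ 1∕4`
# and `Σ_{t<K−J} s_{t+1}² ≤ 3·E(L)` — DEPTH- and VOLUME-FREE; px17 g19's ✓`exists_gamma_supBudget` is the case `V = 1`

Cell `ym3-torus` (YM ladder rung R3 = continuum `SU(2)` Yang–Mills on the three-torus — a RUNG: NOT d = 4, NOT infinite volume, NOT a mass gap,
NOT Clay).  Width seat «width 12» `ym3-torus-px12` (gen 24), FREE px helper on crux `stmt-QuantumFields-20520`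
(`Theses.UnitScaleTilt.FluctuationComparisonRegPrIntL`); `--kind proof --supports stmt-QuantumFields-20520 --as helper`, count-neutral, DEFINITION-FREE
(0 `def`, 0 `instance`, 0 `notation`, 0 `sorry`, default heartbeats).

WHAT (UV3-NODE §84.4 «(L♭) along the towers ⟸ ✓p822698 + a two-tower sup profile with a SMALL NON-ZERO START — S, un-held»; this seat takes it).
★★★ `exists_gamma_supBudget_start (L) (hL) (b₀ p₀)` : `∃ M > 0` (block-size constant, `M ≤ 1∕4`), `∃ E ≥ 0`, `∃ γ₁ > 0` such that for every `T3Family` with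
`F.L = L`, `0 < γ ≤ γ₁`, every `J ≤ K`, every datum `V` WITH BOND ARCS `≤ M`, every `U ∈ fibre(V) ∩ histGood`, and every gauge family `g` with the tower facts
(hat-lift formulas, (T1) top, (T4) comb axiality, (T5) consistency — the hypotheses of px17's budget VERBATIM), there is a profile `s ≥ 0` bounding the arcs of
every gauged level `g_t•M^tU` (`t ≤ K − J`) with `s t ≤ M` and `Σ_{t<K−J} s (t+1)² ≤ 3E`.  PROOF = px17's proof with (i) the general-top profile
✓∕⧗`exists_supProfile_relativeTower_start` (start `s (K−J) ≤ M` from `V`'s bonds through the descent: `M^{K−J}U b = V(bondShift⁻¹ b)`, lit ✓`fieldShift_apply`),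
(ii) the bootstrap-from-a-start ✓∕⧗`sq_budget_of_start` (`C₂M ≤ (1 − L⁻¹)∕2`, `Σρ ≤ (1 − L⁻¹)M∕2` by ✓`thresholdSum_small`), (iii) the same constants
`r₀ = L⁻¹`, `A₁`, `A₂`, `C₂ = (π∕2)·N_P·24·L⁻²`.  CONSUMER: ✓∕⧗`…S2BetaChartLetterOfSupProfile.chartLetter_along_towers` (one profile per tower, `s := max`;
guards `s_t² ≤ 3` from `s_t ≤ M ≤ 1∕4`) ⟹ the (L♭) half of ✓p822621 `dockRel_inner`'s letter, modulo ONLY the datum's small-bond gauge `arc(V e) ≤ M(L)`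
(✓p822838 `…S2BetaDatumGaugeWLOG`'s guard `G′`; `M(L) = min(1∕4, (1 − L⁻¹)∕(2(C₂ + 1)))`, `C₂ = 12π(L² − 1)∕L²` at `d = 3`: `M(5) ≈ 0.0104`).

HONEST SCOPE.  Bookkeeping over landed estimates with px17's constants; the datum's small-bond gauge is a HYPOTHESIS (`hVσ`); nothing of Bałaban's analysis
is asserted ([Balaban1985RegularSpaces] Lemma 1 (1.24)–(1.26) p.79, (1.65) p.87; [Balaban1987RG1] (0.4) p.253); (L♭)'s final assembly, (H♭), (D♮), GAP♯∘
(`stub_uniformFibreGapOrbit`), S2β, crux 20520 and `YM3TorusSU2` are NOT proved; no registered stub is closed; rung R3 = SU(2) YM₃ on T³ — NOT d = 4, NOT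
infinite volume, NOT a mass gap, NOT Clay; the Yang–Mills mass gap is NOT proved.
-/

set_option autoImplicit false

noncomputable section

namespace Summit.QuantumFields.YangMills.Theorems.FluctuationComparisonRegPrIntLS2BetaRelativeTowerSupBudgetStart

open Finset
open scoped Real
open Literature.MathematicalPhysics.QuantumLattice (su2Quat)
open Literature.MathematicalPhysics.QuantumFieldTheory.Balaban1983to89
open T4Continuum T3ContinuumYM3Torus T3UnitScaleTilt T3TiltDescent T3LevelShift BlockAveraging
open T4CubeChartGnomonic (SU2)
open T4HaarSU2ExpChart (expPoint)
open T4ExpWindowSmallField (logVec)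
open T3UnitLawDensityEML (ℰp)
open T3ConstrainedMinimiser (fibre)
open B10Eq27TorusAxialLog (rel axialT)
open Summit.QuantumFields.YangMills.Theorems.FluctuationComparisonRegPrIntLS2BetaRelativeTowerSupProfileStart (exists_supProfile_relativeTower_start)
open Summit.QuantumFields.YangMills.Theorems.FluctuationComparisonRegPrIntLS2BetaContractingSupStart (sq_budget_of_start)
open Summit.QuantumFields.YangMills.Theorems.FluctuationComparisonRegPrIntLS2BetaThresholdSum (thresholdSum_small)

/-- **THE TOP OF THE TOWER IS THE DATUM, BOND BY BOND**: `U ∈ fibre(V)` ⟹ every bond value of `M^{K−J}U` is a bond value of `V`, so a bound on the arcs of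
`V`'s bonds is a bound on the arcs of the top field (lit ✓`fieldShift_apply`). [cite: Balaban1987RG1, (0.1) p.251, (0.11) p.253] -/
theorem norm_logVec_iter_le_of_mem_fibre (F : T3Family) {J K : ℕ} (hJK : J ≤ K) {V : GaugeField (F.P J) 0 SU2}
    {U : GaugeField (F.P K) 0 SU2} (hU : U ∈ fibre F ℰp J K hJK V) {σ : ℝ} (hVσ : ∀ e, ‖logVec (su2Quat (V e))‖ ≤ σ)
    (b : PBond (F.P K) (K - J)) :
    ‖logVec (su2Quat (Averaging.iter (fun k => blockAvg (P := F.P K) (j := k) ℰp) (K - J) U b))‖ ≤ σ := by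
  have h : fieldShift (F.sitesPerDir_eq (m := F.m) (K := J) (j := 0) (m' := F.m) (K' := K) (j' := K - J) (by omega))
      (Averaging.iter (fun k => blockAvg (P := F.P K) (j := k) ℰp) (K - J) U) = V := hU
  have hb := congrFun h ((bondShift (F.sitesPerDir_eq (m := F.m) (K := J) (j := 0) (m' := F.m) (K' := K) (j' := K - J) (by omega))).symm b)
  rw [fieldShift_apply, Equiv.apply_symm_apply] at hb
  rw [hb]
  exact hVσ _

/-- ★★★ **THE SUP BUDGET OVER A NON-FLAT DATUM, T³ READING** (px17 g19's ✓`exists_gamma_supBudget` with the flat top `V = 1` replaced by any datum whose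
bonds have arcs `≤ M(L)`): `∃ M ∈ (0, 1∕4]`, `∃ E ≥ 0`, `∃ γ₁ > 0`, such that for `F.L = L`, `0 < γ ≤ γ₁`, `J ≤ K`, `V` with `arc(V e) ≤ M`, `U ∈ fibre(V) ∩
histGood`, and a gauge family with the stage tower's facts, a profile `s ≥ 0` bounds the arcs of every gauged level with `s t ≤ M` and
`Σ_{t<K−J} s (t+1)² ≤ 3E`. [cite: Balaban1985RegularSpaces, Lemma 1 (1.24)-(1.26) p.79, (1.65) p.87; Balaban1987RG1, (0.4) p.253] -/
theorem exists_gamma_supBudget_start (L : ℕ) (hL : 1 < L) (b₀ p₀ : ℝ) (hb : 0 < b₀) (hp : 0 < p₀) :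
    ∃ M : ℝ, 0 < M ∧ M ≤ 1 / 4 ∧ ∃ E : ℝ, 0 ≤ E ∧ ∃ γ₁ : ℝ, 0 < γ₁ ∧ ∀ (F : T3Family) (γ : ℝ), F.L = L → 0 < γ → γ ≤ γ₁ →
      ∀ (J K : ℕ) (hJK : J ≤ K) (Vd : GaugeField (F.P J) 0 SU2), (∀ e, ‖logVec (su2Quat (Vd e))‖ ≤ M) →
      ∀ (U : GaugeField (F.P K) 0 SU2), U ∈ fibre F ℰp J K hJK Vd → U ∈ histGood F ℰp (θBal F.L γ b₀ p₀) K J →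
      ∀ (g : (j : ℕ) → Site (F.P K) j → SU2) (w : (t : ℕ) → PBond (F.P K) t → PBond (F.P K) (t + 1) → ℝ)
        (V : (t : ℕ) → GaugeField (F.P K) t SU2),
        (∀ t, t < K - J → ∀ b e, w t b e = if e.dir = b.dir ∧ (b.src b.dir - emb e.src b.dir).val < (F.P K).L then
          ∏ ν ∈ Finset.univ.erase b.dir, max 0 (1 - ((rel (emb e.src) b.src ν).natAbs : ℝ) / (F.P K).L) else 0) →
        (∀ t, t < K - J → ∀ b, V t b = expPoint (∑ e, w t b e • ((((F.P K).L : ℕ) : ℝ)⁻¹ •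
          logVec (su2Quat (GaugeField.gaugeAct (g (t + 1)) (Averaging.iter (fun k => blockAvg (P := F.P K) (j := k) ℰp) (t + 1) U) e))))) →
        (∀ j, K - J ≤ j → ∀ y, g j y = 1) →
        (∀ t, t < K - J → ∀ z : Site (F.P K) t,
          axialT (GaugeField.gaugeAct (g t) (Averaging.iter (fun k => blockAvg (P := F.P K) (j := k) ℰp) t U)) (emb (blockOf z)) z =
            axialT (V t) (emb (blockOf z)) z) →
        (∀ t, t < K - J → avgFun ℰp (GaugeField.gaugeAct (g t) (Averaging.iter (fun k => blockAvg (P := F.P K) (j := k) ℰp) t U)) =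
          GaugeField.gaugeAct (g (t + 1)) (Averaging.iter (fun k => blockAvg (P := F.P K) (j := k) ℰp) (t + 1) U)) →
        ∃ s : ℕ → ℝ, (∀ t, 0 ≤ s t) ∧
          (∀ t, t ≤ K - J → ∀ b, ‖logVec (su2Quat (GaugeField.gaugeAct (g t) (Averaging.iter (fun k => blockAvg (P := F.P K) (j := k) ℰp) t U) b))‖ ≤ s t) ∧
          (∀ t, t ≤ K - J → s t ≤ M) ∧ ∑ t ∈ range (K - J), s (t + 1) ^ 2 ≤ 3 * E := by
  -- the constants of the one-level step at `d = 3`, block size `L` (px17's)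
  have hL' : (1 : ℝ) < L := by exact_mod_cast hL
  have hL0 : (0 : ℝ) < L := by linarith
  obtain ⟨NP, hNP⟩ : ∃ x : ℝ, x = (((3 - 1) * ((L - 1) / 2) * (L + 1) : ℕ) : ℝ) := ⟨_, rfl⟩
  obtain ⟨G, hG⟩ : ∃ x : ℝ, x = ((((3 + 2) * L : ℕ) : ℝ) ^ 2 / 4) := ⟨_, rfl⟩
  have hNP0 : 0 ≤ NP := by rw [hNP]; positivity
  have hG0 : 0 < G := by rw [hG]; positivity
  obtain ⟨A₁, hA₁⟩ : ∃ x : ℝ, x = π / 2 * (NP + 2 * G) := ⟨_, rfl⟩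
  obtain ⟨A₂, hA₂⟩ : ∃ x : ℝ, x = π / 2 * (NP * ((L : ℝ)⁻¹) ^ 2 * (π / 2)) := ⟨_, rfl⟩
  obtain ⟨C₂, hC₂⟩ : ∃ x : ℝ, x = π / 2 * NP * 24 * ((L : ℝ)⁻¹) ^ 2 := ⟨_, rfl⟩
  obtain ⟨r₀, hr₀⟩ : ∃ x : ℝ, x = (L : ℝ)⁻¹ := ⟨_, rfl⟩
  have hA₁0 : 0 ≤ A₁ := by rw [hA₁]; positivity
  have hA₂0 : 0 ≤ A₂ := by rw [hA₂]; positivity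
  have hC₂0 : 0 ≤ C₂ := by rw [hC₂]; positivity
  have hr00 : 0 ≤ r₀ := by rw [hr₀]; positivity
  have hr01 : r₀ < 1 := by rw [hr₀]; exact inv_lt_one_of_one_lt₀ hL'
  have h1r : 0 < 1 - r₀ := by linarith
  -- the ceiling `M` and the threshold budget `Smax`
  obtain ⟨M, hM⟩ : ∃ x : ℝ, x = min (1 / 4) ((1 - r₀) / (2 * (C₂ + 1))) := ⟨_, rfl⟩
  have hM0 : 0 < M := by rw [hM]; exact lt_min (by norm_num) (by positivity)
  have hM4 : M ≤ 1 / 4 := by rw [hM]; exact min_le_left _ _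
  have hMC : C₂ * M ≤ (1 - r₀) / 2 := by
    have h1 : M ≤ (1 - r₀) / (2 * (C₂ + 1)) := by rw [hM]; exact min_le_right _ _
    calc C₂ * M ≤ (C₂ + 1) * ((1 - r₀) / (2 * (C₂ + 1))) := by nlinarith
      _ = (1 - r₀) / 2 := by field_simp
  obtain ⟨Smax, hSmax⟩ : ∃ x : ℝ, x = (1 - r₀) / 2 * M := ⟨_, rfl⟩
  have hSmax0 : 0 < Smax := by rw [hSmax]; positivity
  -- the linearised ratio and the budget `E`
  obtain ⟨q, hq⟩ : ∃ x : ℝ, x = r₀ + C₂ * M := ⟨_, rfl⟩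
  have hq0 : 0 ≤ q := by rw [hq]; positivity
  have hq1 : q < 1 := by rw [hq]; linarith
  obtain ⟨E, hE⟩ : ∃ x : ℝ, x = M * ((q * M + Smax) / (1 - q) + M) / 3 := ⟨_, rfl⟩
  have hE0 : 0 ≤ E := by
    rw [hE]
    have : 0 ≤ (q * M + Smax) / (1 - q) := div_nonneg (by positivity) (by linarith)
    positivity
  -- the size guard for a single threshold: the `ℰp` guards (px17's `a₀`)
  have hδSU := ExpMeanLog.deltaSU_pos (n := Fin 2)
  obtain ⟨a₀, ha₀⟩ : ∃ x : ℝ, x = min (min (ExpMeanLog.deltaSU (Fin 2) / (2 * G)) (1 / (6 * G))) (Smax / (2 * (A₂ + 1))) := ⟨_, rfl⟩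
  have ha₀0 : 0 < a₀ := by rw [ha₀]; exact lt_min (lt_min (by positivity) (by positivity)) (by positivity)
  obtain ⟨γ₁, hγ₁, hth⟩ := thresholdSum_small L hL b₀ p₀ hb hp (A₁ + A₂) a₀ (Smax / 2) (by positivity) ha₀0 (by positivity)
  refine ⟨M, hM0, hM4, E, hE0, γ₁, hγ₁, fun F γ hFL hγ hγ1 J K hJK Vd hVσ U hUf hUg g w V hw hV hT1 hax hT5 => ?_⟩
  obtain ⟨hθa, hsum⟩ := hth γ hγ hγ1
  have hPd : (F.P K).d = 3 := rfl
  have hPL : (F.P K).L = L := hFL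
  rw [hFL] at hUg
  have hm : K - J ≤ (F.P K).m + (F.P K).K := by show K - J ≤ F.m + K; omega
  -- thresholds on the gauged levels (gauge invariance of plaquette sizes)
  set θ : ℕ → ℝ := fun t => θBal L γ b₀ p₀ (K - t) with hθ
  have hθ0 : ∀ t, 0 ≤ θ t := fun t => (hθa _).1
  have hθa' : ∀ t, θ t ≤ a₀ := fun t => (hθa _).2
  have hθU : ∀ t, t ≤ K - J → PlaqSmall (θ t) (GaugeField.gaugeAct (g t) (Averaging.iter (fun k => blockAvg (P := F.P K) (j := k) ℰp) t U)) := by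
    intro t ht p
    rw [T4ReTrLipUnitary.plaqHol_gaugeAct, GaugeGroup.dist1_conj]
    exact hUg t (by omega) p
  -- the guards from `θ ≤ a₀`
  have hGa : G * a₀ < ExpMeanLog.deltaSU (Fin 2) ∧ G * a₀ ≤ 1 / 6 := by
    have h1 : a₀ ≤ ExpMeanLog.deltaSU (Fin 2) / (2 * G) := by rw [ha₀]; exact (min_le_left _ _).trans (min_le_left _ _)
    have h2 : a₀ ≤ 1 / (6 * G) := by rw [ha₀]; exact (min_le_left _ _).trans (min_le_right _ _)
    constructor
    · calc G * a₀ ≤ G * (ExpMeanLog.deltaSU (Fin 2) / (2 * G)) := mul_le_mul_of_nonneg_left h1 hG0.le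
        _ = ExpMeanLog.deltaSU (Fin 2) / 2 := by field_simp
        _ < ExpMeanLog.deltaSU (Fin 2) := by linarith
    · calc G * a₀ ≤ G * (1 / (6 * G)) := mul_le_mul_of_nonneg_left h2 hG0.le
        _ = 1 / 6 := by field_simp
  have hg1 : ∀ t, t < K - J → (((((F.P K).d + 2) * (F.P K).L : ℕ) : ℝ) ^ 2 / 4) * θ t < ExpMeanLog.deltaSU (Fin 2) := by
    intro t _; rw [hPd, hPL, ← hG]
    exact lt_of_le_of_lt (mul_le_mul_of_nonneg_left (hθa' t) hG0.le) hGa.1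
  have hg2 : ∀ t, t < K - J → (((((F.P K).d + 2) * (F.P K).L : ℕ) : ℝ) ^ 2 / 4) * θ t ≤ 1 / 6 := by
    intro t _; rw [hPd, hPL, ← hG]
    exact le_trans (mul_le_mul_of_nonneg_left (hθa' t) hG0.le) hGa.2
  -- the general-top profile and its conditional quadratic step
  obtain ⟨s, hsm, hs0, hsb, hstep⟩ := exists_supProfile_relativeTower_start hm
    (fun t => GaugeField.gaugeAct (g t) (Averaging.iter (fun k => blockAvg (P := F.P K) (j := k) ℰp) t U)) w V hw hV hax hT5 θ hθ0 hθU hg1 hg2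
  -- the START: the top of the tower is the datum (trivial top gauge), bond by bond
  have hstart : s (K - J) ≤ M := by
    refine hsm M fun b => ?_
    have hg0 : g (K - J) = fun _ => 1 := funext (hT1 (K - J) le_rfl)
    simp only [hg0, T4AxialGaugeFixing.gaugeAct_const_one]
    exact norm_logVec_iter_le_of_mem_fibre F hJK hUf hVσ b
  -- the step in the bootstrap's currency
  set ρ : ℕ → ℝ := fun t => A₁ * θ t + A₂ * θ (t + 1) with hρ
  have hρ0 : ∀ t, 0 ≤ ρ t := fun t => add_nonneg (mul_nonneg hA₁0 (hθ0 t)) (mul_nonneg hA₂0 (hθ0 _))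
  have hstep' : ∀ t, t < K - J → s (t + 1) ≤ 1 / 4 → s t ≤ r₀ * s (t + 1) + ρ t + C₂ * s (t + 1) ^ 2 := by
    intro t ht h4
    have h := hstep t ht h4
    rw [hPd, hPL] at h
    refine h.trans (le_of_eq ?_)
    simp only [hρ, hA₁, hA₂, hC₂, hr₀, hNP, hG]
    ring
  -- the threshold sum: `Σ_{t<m} ρ t ≤ (A₁ + A₂)·Σθ + A₂·a₀ ≤ Smax` (px17's count verbatim)
  have hSρ : ∑ t ∈ range (K - J), ρ t ≤ Smax := by
    have hs1 : ∑ t ∈ range (K - J), ρ t =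
        A₁ * ∑ t ∈ range (K - J), θ t + A₂ * ∑ t ∈ range (K - J), θ (t + 1) := by
      simp only [hρ, sum_add_distrib, mul_sum]
    have hshift : ∑ t ∈ range (K - J), θ (t + 1) ≤ ∑ t ∈ range (K - J), θ t + a₀ := by
      rcases Nat.eq_zero_or_pos (K - J) with h0 | hpos
      · rw [h0]; simp [ha₀0.le]
      · obtain ⟨m, hm'⟩ : ∃ m, K - J = m + 1 := ⟨K - J - 1, by omega⟩
        rw [hm', Finset.sum_range_succ' θ, Finset.sum_range_succ (fun t => θ (t + 1))]
        have := hθ0 0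
        have := hθa' (m + 1)
        linarith
    have hmain := hsum J K hJK
    have hθsum0 : 0 ≤ ∑ t ∈ range (K - J), θ t := sum_nonneg fun t _ => hθ0 t
    have ha₀S : A₂ * a₀ ≤ Smax / 2 := by
      have h3 : a₀ ≤ Smax / (2 * (A₂ + 1)) := by rw [ha₀]; exact min_le_right _ _
      calc A₂ * a₀ ≤ A₂ * (Smax / (2 * (A₂ + 1))) := mul_le_mul_of_nonneg_left h3 hA₂0
        _ ≤ (A₂ + 1) * (Smax / (2 * (A₂ + 1))) := mul_le_mul_of_nonneg_right (by linarith) (by positivity)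
        _ = Smax / 2 := by field_simp
    rw [hs1]
    have hA₂sh := mul_le_mul_of_nonneg_left hshift hA₂0
    calc A₁ * ∑ t ∈ range (K - J), θ t + A₂ * ∑ t ∈ range (K - J), θ (t + 1)
        ≤ A₁ * ∑ t ∈ range (K - J), θ t + A₂ * (∑ t ∈ range (K - J), θ t + a₀) := by linarith
      _ = (A₁ + A₂) * ∑ i ∈ range (K - J), θBal L γ b₀ p₀ (K - i) + A₂ * a₀ := by simp only [hθ]; ring
      _ ≤ Smax / 2 + Smax / 2 := add_le_add hmain ha₀S
      _ = Smax := by ring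
  -- the bootstrap from the start (✓`sq_budget_of_start`)
  have hsmall₁ : Smax ≤ (1 - r₀) / 2 * M := by rw [hSmax]
  obtain ⟨hall, hsq⟩ := sq_budget_of_start s ρ (K - J) r₀ C₂ (1 / 4) M Smax hstart hs0 hρ0 hSρ hstep' hr00 hr01 hC₂0 hM4 hsmall₁ hMC
  refine ⟨s, hs0, hsb, hall, hsq.trans ?_⟩
  -- `M·((q·s_top + Σρ)∕(1 − q) + s_top) ≤ M·((q·M + Smax)∕(1 − q) + M) = 3E`
  rw [← hq] at hsq ⊢
  have h1q : 0 < 1 - q := by linarith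
  have hnum : q * s (K - J) + ∑ t ∈ range (K - J), ρ t ≤ q * M + Smax := add_le_add (mul_le_mul_of_nonneg_left hstart hq0) hSρ
  have hdiv : (q * s (K - J) + ∑ t ∈ range (K - J), ρ t) / (1 - q) ≤ (q * M + Smax) / (1 - q) := div_le_div_of_nonneg_right hnum h1q.le
  calc M * ((q * s (K - J) + ∑ t ∈ range (K - J), ρ t) / (1 - q) + s (K - J))
      ≤ M * ((q * M + Smax) / (1 - q) + M) := mul_le_mul_of_nonneg_left (add_le_add hdiv hstart) hM0.le
    _ = 3 * E := by rw [hE]; ring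


open Summit.QuantumFields.YangMills.Theorems.FluctuationComparisonRegPrIntLS2BetaContractingSupStart
  (linearised_of_bootstrap_start sum_succ_le_of_contract_start)

/-- ★★★ **THE SUP BUDGET OVER A NON-FLAT DATUM — ℓ¹ EDITION**: ✓`exists_gamma_supBudget_start` with the additional conjunct
`Σ_{t<K−J} s(t+1) ≤ 3E∕M` (the contracting profile's ℓ¹ sum, ✓`sum_succ_le_of_contract_start`; the ℓ² budget is `M` times it).  Needed by the (H♭♭)
FEEDERS door's `e`-budget (`Σ_j φ_j`, `φ_j ∝` the two coarse levels' sup arcs, (F3)-rel). [cite: Balaban1985RegularSpaces, Lemma 1 p.79, (1.29) p.81] -/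
theorem exists_gamma_supBudget_start_l1 (L : ℕ) (hL : 1 < L) (b₀ p₀ : ℝ) (hb : 0 < b₀) (hp : 0 < p₀) :
    ∃ M : ℝ, 0 < M ∧ M ≤ 1 / 4 ∧ ∃ E : ℝ, 0 ≤ E ∧ ∃ γ₁ : ℝ, 0 < γ₁ ∧ ∀ (F : T3Family) (γ : ℝ), F.L = L → 0 < γ → γ ≤ γ₁ →
      ∀ (J K : ℕ) (hJK : J ≤ K) (Vd : GaugeField (F.P J) 0 SU2), (∀ e, ‖logVec (su2Quat (Vd e))‖ ≤ M) →
      ∀ (U : GaugeField (F.P K) 0 SU2), U ∈ fibre F ℰp J K hJK Vd → U ∈ histGood F ℰp (θBal F.L γ b₀ p₀) K J →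
      ∀ (g : (j : ℕ) → Site (F.P K) j → SU2) (w : (t : ℕ) → PBond (F.P K) t → PBond (F.P K) (t + 1) → ℝ)
        (V : (t : ℕ) → GaugeField (F.P K) t SU2),
        (∀ t, t < K - J → ∀ b e, w t b e = if e.dir = b.dir ∧ (b.src b.dir - emb e.src b.dir).val < (F.P K).L then
          ∏ ν ∈ Finset.univ.erase b.dir, max 0 (1 - ((rel (emb e.src) b.src ν).natAbs : ℝ) / (F.P K).L) else 0) →
        (∀ t, t < K - J → ∀ b, V t b = expPoint (∑ e, w t b e • ((((F.P K).L : ℕ) : ℝ)⁻¹ •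
          logVec (su2Quat (GaugeField.gaugeAct (g (t + 1)) (Averaging.iter (fun k => blockAvg (P := F.P K) (j := k) ℰp) (t + 1) U) e))))) →
        (∀ j, K - J ≤ j → ∀ y, g j y = 1) →
        (∀ t, t < K - J → ∀ z : Site (F.P K) t,
          axialT (GaugeField.gaugeAct (g t) (Averaging.iter (fun k => blockAvg (P := F.P K) (j := k) ℰp) t U)) (emb (blockOf z)) z =
            axialT (V t) (emb (blockOf z)) z) →
        (∀ t, t < K - J → avgFun ℰp (GaugeField.gaugeAct (g t) (Averaging.iter (fun k => blockAvg (P := F.P K) (j := k) ℰp) t U)) =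
          GaugeField.gaugeAct (g (t + 1)) (Averaging.iter (fun k => blockAvg (P := F.P K) (j := k) ℰp) (t + 1) U)) →
        ∃ s : ℕ → ℝ, (∀ t, 0 ≤ s t) ∧
          (∀ t, t ≤ K - J → ∀ b, ‖logVec (su2Quat (GaugeField.gaugeAct (g t) (Averaging.iter (fun k => blockAvg (P := F.P K) (j := k) ℰp) t U) b))‖ ≤ s t) ∧
          (∀ t, t ≤ K - J → s t ≤ M) ∧ ∑ t ∈ range (K - J), s (t + 1) ≤ 3 * E / M ∧ ∑ t ∈ range (K - J), s (t + 1) ^ 2 ≤ 3 * E := by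
  -- the constants of the one-level step at `d = 3`, block size `L` (px17's)
  have hL' : (1 : ℝ) < L := by exact_mod_cast hL
  have hL0 : (0 : ℝ) < L := by linarith
  obtain ⟨NP, hNP⟩ : ∃ x : ℝ, x = (((3 - 1) * ((L - 1) / 2) * (L + 1) : ℕ) : ℝ) := ⟨_, rfl⟩
  obtain ⟨G, hG⟩ : ∃ x : ℝ, x = ((((3 + 2) * L : ℕ) : ℝ) ^ 2 / 4) := ⟨_, rfl⟩
  have hNP0 : 0 ≤ NP := by rw [hNP]; positivity
  have hG0 : 0 < G := by rw [hG]; positivity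
  obtain ⟨A₁, hA₁⟩ : ∃ x : ℝ, x = π / 2 * (NP + 2 * G) := ⟨_, rfl⟩
  obtain ⟨A₂, hA₂⟩ : ∃ x : ℝ, x = π / 2 * (NP * ((L : ℝ)⁻¹) ^ 2 * (π / 2)) := ⟨_, rfl⟩
  obtain ⟨C₂, hC₂⟩ : ∃ x : ℝ, x = π / 2 * NP * 24 * ((L : ℝ)⁻¹) ^ 2 := ⟨_, rfl⟩
  obtain ⟨r₀, hr₀⟩ : ∃ x : ℝ, x = (L : ℝ)⁻¹ := ⟨_, rfl⟩
  have hA₁0 : 0 ≤ A₁ := by rw [hA₁]; positivity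
  have hA₂0 : 0 ≤ A₂ := by rw [hA₂]; positivity
  have hC₂0 : 0 ≤ C₂ := by rw [hC₂]; positivity
  have hr00 : 0 ≤ r₀ := by rw [hr₀]; positivity
  have hr01 : r₀ < 1 := by rw [hr₀]; exact inv_lt_one_of_one_lt₀ hL'
  have h1r : 0 < 1 - r₀ := by linarith
  -- the ceiling `M` and the threshold budget `Smax`
  obtain ⟨M, hM⟩ : ∃ x : ℝ, x = min (1 / 4) ((1 - r₀) / (2 * (C₂ + 1))) := ⟨_, rfl⟩
  have hM0 : 0 < M := by rw [hM]; exact lt_min (by norm_num) (by positivity)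
  have hM4 : M ≤ 1 / 4 := by rw [hM]; exact min_le_left _ _
  have hMC : C₂ * M ≤ (1 - r₀) / 2 := by
    have h1 : M ≤ (1 - r₀) / (2 * (C₂ + 1)) := by rw [hM]; exact min_le_right _ _
    calc C₂ * M ≤ (C₂ + 1) * ((1 - r₀) / (2 * (C₂ + 1))) := by nlinarith
      _ = (1 - r₀) / 2 := by field_simp
  obtain ⟨Smax, hSmax⟩ : ∃ x : ℝ, x = (1 - r₀) / 2 * M := ⟨_, rfl⟩
  have hSmax0 : 0 < Smax := by rw [hSmax]; positivity
  -- the linearised ratio and the budget `E`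
  obtain ⟨q, hq⟩ : ∃ x : ℝ, x = r₀ + C₂ * M := ⟨_, rfl⟩
  have hq0 : 0 ≤ q := by rw [hq]; positivity
  have hq1 : q < 1 := by rw [hq]; linarith
  obtain ⟨E, hE⟩ : ∃ x : ℝ, x = M * ((q * M + Smax) / (1 - q) + M) / 3 := ⟨_, rfl⟩
  have hE0 : 0 ≤ E := by
    rw [hE]
    have : 0 ≤ (q * M + Smax) / (1 - q) := div_nonneg (by positivity) (by linarith)
    positivity
  -- the size guard for a single threshold: the `ℰp` guards (px17's `a₀`)
  have hδSU := ExpMeanLog.deltaSU_pos (n := Fin 2)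
  obtain ⟨a₀, ha₀⟩ : ∃ x : ℝ, x = min (min (ExpMeanLog.deltaSU (Fin 2) / (2 * G)) (1 / (6 * G))) (Smax / (2 * (A₂ + 1))) := ⟨_, rfl⟩
  have ha₀0 : 0 < a₀ := by rw [ha₀]; exact lt_min (lt_min (by positivity) (by positivity)) (by positivity)
  obtain ⟨γ₁, hγ₁, hth⟩ := thresholdSum_small L hL b₀ p₀ hb hp (A₁ + A₂) a₀ (Smax / 2) (by positivity) ha₀0 (by positivity)
  refine ⟨M, hM0, hM4, E, hE0, γ₁, hγ₁, fun F γ hFL hγ hγ1 J K hJK Vd hVσ U hUf hUg g w V hw hV hT1 hax hT5 => ?_⟩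
  obtain ⟨hθa, hsum⟩ := hth γ hγ hγ1
  have hPd : (F.P K).d = 3 := rfl
  have hPL : (F.P K).L = L := hFL
  rw [hFL] at hUg
  have hm : K - J ≤ (F.P K).m + (F.P K).K := by show K - J ≤ F.m + K; omega
  -- thresholds on the gauged levels (gauge invariance of plaquette sizes)
  set θ : ℕ → ℝ := fun t => θBal L γ b₀ p₀ (K - t) with hθ
  have hθ0 : ∀ t, 0 ≤ θ t := fun t => (hθa _).1
  have hθa' : ∀ t, θ t ≤ a₀ := fun t => (hθa _).2
  have hθU : ∀ t, t ≤ K - J → PlaqSmall (θ t) (GaugeField.gaugeAct (g t) (Averaging.iter (fun k => blockAvg (P := F.P K) (j := k) ℰp) t U)) := by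
    intro t ht p
    rw [T4ReTrLipUnitary.plaqHol_gaugeAct, GaugeGroup.dist1_conj]
    exact hUg t (by omega) p
  -- the guards from `θ ≤ a₀`
  have hGa : G * a₀ < ExpMeanLog.deltaSU (Fin 2) ∧ G * a₀ ≤ 1 / 6 := by
    have h1 : a₀ ≤ ExpMeanLog.deltaSU (Fin 2) / (2 * G) := by rw [ha₀]; exact (min_le_left _ _).trans (min_le_left _ _)
    have h2 : a₀ ≤ 1 / (6 * G) := by rw [ha₀]; exact (min_le_left _ _).trans (min_le_right _ _)
    constructor
    · calc G * a₀ ≤ G * (ExpMeanLog.deltaSU (Fin 2) / (2 * G)) := mul_le_mul_of_nonneg_left h1 hG0.le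
        _ = ExpMeanLog.deltaSU (Fin 2) / 2 := by field_simp
        _ < ExpMeanLog.deltaSU (Fin 2) := by linarith
    · calc G * a₀ ≤ G * (1 / (6 * G)) := mul_le_mul_of_nonneg_left h2 hG0.le
        _ = 1 / 6 := by field_simp
  have hg1 : ∀ t, t < K - J → (((((F.P K).d + 2) * (F.P K).L : ℕ) : ℝ) ^ 2 / 4) * θ t < ExpMeanLog.deltaSU (Fin 2) := by
    intro t _; rw [hPd, hPL, ← hG]
    exact lt_of_le_of_lt (mul_le_mul_of_nonneg_left (hθa' t) hG0.le) hGa.1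
  have hg2 : ∀ t, t < K - J → (((((F.P K).d + 2) * (F.P K).L : ℕ) : ℝ) ^ 2 / 4) * θ t ≤ 1 / 6 := by
    intro t _; rw [hPd, hPL, ← hG]
    exact le_trans (mul_le_mul_of_nonneg_left (hθa' t) hG0.le) hGa.2
  -- the general-top profile and its conditional quadratic step
  obtain ⟨s, hsm, hs0, hsb, hstep⟩ := exists_supProfile_relativeTower_start hm
    (fun t => GaugeField.gaugeAct (g t) (Averaging.iter (fun k => blockAvg (P := F.P K) (j := k) ℰp) t U)) w V hw hV hax hT5 θ hθ0 hθU hg1 hg2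
  -- the START: the top of the tower is the datum (trivial top gauge), bond by bond
  have hstart : s (K - J) ≤ M := by
    refine hsm M fun b => ?_
    have hg0 : g (K - J) = fun _ => 1 := funext (hT1 (K - J) le_rfl)
    simp only [hg0, T4AxialGaugeFixing.gaugeAct_const_one]
    exact norm_logVec_iter_le_of_mem_fibre F hJK hUf hVσ b
  -- the step in the bootstrap's currency
  set ρ : ℕ → ℝ := fun t => A₁ * θ t + A₂ * θ (t + 1) with hρ
  have hρ0 : ∀ t, 0 ≤ ρ t := fun t => add_nonneg (mul_nonneg hA₁0 (hθ0 t)) (mul_nonneg hA₂0 (hθ0 _))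
  have hstep' : ∀ t, t < K - J → s (t + 1) ≤ 1 / 4 → s t ≤ r₀ * s (t + 1) + ρ t + C₂ * s (t + 1) ^ 2 := by
    intro t ht h4
    have h := hstep t ht h4
    rw [hPd, hPL] at h
    refine h.trans (le_of_eq ?_)
    simp only [hρ, hA₁, hA₂, hC₂, hr₀, hNP, hG]
    ring
  -- the threshold sum: `Σ_{t<m} ρ t ≤ (A₁ + A₂)·Σθ + A₂·a₀ ≤ Smax` (px17's count verbatim)
  have hSρ : ∑ t ∈ range (K - J), ρ t ≤ Smax := by
    have hs1 : ∑ t ∈ range (K - J), ρ t =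
        A₁ * ∑ t ∈ range (K - J), θ t + A₂ * ∑ t ∈ range (K - J), θ (t + 1) := by
      simp only [hρ, sum_add_distrib, mul_sum]
    have hshift : ∑ t ∈ range (K - J), θ (t + 1) ≤ ∑ t ∈ range (K - J), θ t + a₀ := by
      rcases Nat.eq_zero_or_pos (K - J) with h0 | hpos
      · rw [h0]; simp [ha₀0.le]
      · obtain ⟨m, hm'⟩ : ∃ m, K - J = m + 1 := ⟨K - J - 1, by omega⟩
        rw [hm', Finset.sum_range_succ' θ, Finset.sum_range_succ (fun t => θ (t + 1))]
        have := hθ0 0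
        have := hθa' (m + 1)
        linarith
    have hmain := hsum J K hJK
    have hθsum0 : 0 ≤ ∑ t ∈ range (K - J), θ t := sum_nonneg fun t _ => hθ0 t
    have ha₀S : A₂ * a₀ ≤ Smax / 2 := by
      have h3 : a₀ ≤ Smax / (2 * (A₂ + 1)) := by rw [ha₀]; exact min_le_right _ _
      calc A₂ * a₀ ≤ A₂ * (Smax / (2 * (A₂ + 1))) := mul_le_mul_of_nonneg_left h3 hA₂0
        _ ≤ (A₂ + 1) * (Smax / (2 * (A₂ + 1))) := mul_le_mul_of_nonneg_right (by linarith) (by positivity)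
        _ = Smax / 2 := by field_simp
    rw [hs1]
    have hA₂sh := mul_le_mul_of_nonneg_left hshift hA₂0
    calc A₁ * ∑ t ∈ range (K - J), θ t + A₂ * ∑ t ∈ range (K - J), θ (t + 1)
        ≤ A₁ * ∑ t ∈ range (K - J), θ t + A₂ * (∑ t ∈ range (K - J), θ t + a₀) := by linarith
      _ = (A₁ + A₂) * ∑ i ∈ range (K - J), θBal L γ b₀ p₀ (K - i) + A₂ * a₀ := by simp only [hθ]; ring
      _ ≤ Smax / 2 + Smax / 2 := add_le_add hmain ha₀S
      _ = Smax := by ring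
  -- the bootstrap from the start (✓`sq_budget_of_start`)
  have hsmall₁ : Smax ≤ (1 - r₀) / 2 * M := by rw [hSmax]
  obtain ⟨hall, hsq⟩ := sq_budget_of_start s ρ (K - J) r₀ C₂ (1 / 4) M Smax hstart hs0 hρ0 hSρ hstep' hr00 hr01 hC₂0 hM4 hsmall₁ hMC
  obtain ⟨hq0', hq1', hlin⟩ :=
    linearised_of_bootstrap_start s ρ (K - J) r₀ C₂ (1 / 4) M Smax hstart hs0 hρ0 hSρ hstep' hr00 hr01 hC₂0 hM4 hsmall₁ hMC
  have hl1 := sum_succ_le_of_contract_start _ hq0' hq1' s ρ (K - J) hs0 hlin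
  -- `(q·s_top + Σρ)∕(1 − q) + s_top ≤ (q·M + Smax)∕(1 − q) + M = 3E∕M`
  rw [← hq] at hsq hl1
  have h1q : 0 < 1 - q := by linarith
  have hnum : q * s (K - J) + ∑ t ∈ range (K - J), ρ t ≤ q * M + Smax := add_le_add (mul_le_mul_of_nonneg_left hstart hq0) hSρ
  have hdiv : (q * s (K - J) + ∑ t ∈ range (K - J), ρ t) / (1 - q) ≤ (q * M + Smax) / (1 - q) := div_le_div_of_nonneg_right hnum h1q.le
  have hbound : (q * s (K - J) + ∑ t ∈ range (K - J), ρ t) / (1 - q) + s (K - J) ≤ 3 * E / M := by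
    rw [le_div_iff₀ hM0, hE]
    calc ((q * s (K - J) + ∑ t ∈ range (K - J), ρ t) / (1 - q) + s (K - J)) * M
        ≤ ((q * M + Smax) / (1 - q) + M) * M := mul_le_mul_of_nonneg_right (add_le_add hdiv hstart) hM0.le
      _ = 3 * (M * ((q * M + Smax) / (1 - q) + M) / 3) := by ring
  refine ⟨s, hs0, hsb, hall, hl1.trans hbound, hsq.trans ?_⟩
  calc M * ((q * s (K - J) + ∑ t ∈ range (K - J), ρ t) / (1 - q) + s (K - J))
      ≤ M * (3 * E / M) := mul_le_mul_of_nonneg_left hbound hM0.le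
    _ = 3 * E := by field_simp

end Summit.QuantumFields.YangMills.Theorems.FluctuationComparisonRegPrIntLS2BetaRelativeTowerSupBudgetStart

end
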